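import Summits.HodgeConjecture.CorCM.IrreducibleOddWeightsRestrictionCMFields
import HarnessLib

/-!
# Diminishing returns: the rank of a family of CM types is a SUBMODULAR function of the set of members

COR-CM (cell `pub-hodgecm2`, binder seat `b16` gen 56, count-neutral claim MAX-NONDEG (D-RANK), file F7 — abstract
`G`-set level and CM dress, sequel of F1 `CorCM/IrreducibleOddWeightsRestriction`; theorems only, no definition, no
named fact, no `sorry`).  NEW as stated, hence under `Summits/`.  HONEST FRAMING: finite-dimensional linear algebra
about the Kubota–Dodson rank of families of CM types, read on Mumford–Tate groups of products of abelian varieties with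
complex multiplication; NO hypothesis on the slots (any CM fields, any types); `HC_CM` is neither used nor asserted.

For sub-families `p ⊆ p'` of a family `Φ_i ⊆ E_i` and any slot `i₀`:

> **`finrank_antiSpan_sigmaType_submodular`** — `dim U(Σ|_{p' ∪ {i₀}}) + dim U(Σ|_p) ≤ dim U(Σ|_{p ∪ {i₀}}) + dim U(Σ|_{p'})`:
> the dimension a new member ADDS to the antisymmetric span can only SHRINK as the family grows ("diminishing returns").

With F1 (`dim U(Σ|_p) ≤ dim U(Σ|_{p'})`, monotone) and `dim U(Σ|_∅) = 0` this makes `S ↦ dim U(Σ|_S) = rank(Σ|_S) − 1` a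
POLYMATROID rank function on the set of members; on Mumford–Tate groups (**`cmFamilyRank_submodular`**, any CM fields):
`dim MT(∏_{T' ∪ {i}} A_j) + dim MT(∏_T A_j) ≤ dim MT(∏_{T ∪ {i}} A_j) + dim MT(∏_{T'} A_j)` for `T ⊆ T'`, e.g.
`dim Hg(A × B × C) + dim Hg(A) ≤ dim Hg(A × B) + dim Hg(A × C)`; whole-family form `cmFamilyRank_add_le`.

§2 **`finrank_antiSpan_sigmaType_eq_iff_exists_generated`** (hypothesis-free): the increment of one slot VANISHES iff
the new type vector is an equivariant combination of the kept ones (F1 §2/§3 on the enlarged family; CM form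
**`cmFamilyRank_insert_eq_iff`**, `not_isNondegenerateFamily_insert_of_cmFamilyRank_eq`).

MECHANISM.  The increment `dim U(Σ|_{p∪{i₀}}) − dim U(Σ|_p)` is the dimension of the kernel `K_p` of the restriction
`U(Σ|_{p∪{i₀}}) ↠ U(Σ|_p)` (F1: onto), i.e. of the members of `U(Σ|_{p∪{i₀}})` vanishing on the `p`-slots; restricting
from `p' ∪ {i₀}` to `p ∪ {i₀}` maps `K_{p'}` INJECTIVELY into `K_p` (a member of `K_{p'}` is determined by its
`i₀`-slot).

## References

* [Gordon1999HodgeAVSurvey] B. B. Gordon, *A survey of the Hodge conjecture for abelian varieties*, §3 Theorem (proof),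
  7.5–7.7, 9.1 (ranks of Hodge groups of products).
* [Deligne1982HodgeCycles] P. Deligne, *Hodge cycles on abelian varieties*, LNM 900 (1982), I Ex. 3.7 (c).
* [MoonenZarhin1999LowDim] B. Moonen, Yu. Zarhin, *Hodge classes on abelian varieties of low dimension*, Math. Ann.
  315 (1999), §3 (3.1).
-/

set_option autoImplicit false

noncomputable section

open scoped BigOperators

namespace Summit.HodgeConjecture.CorCM.IrrOdd

open Literature.NumberTheory.ComplexMultiplication

variable {G : Type*} [Group G] {I : Type*} {E : I → Type*} [∀ i, MulAction G (E i)]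

/-! ### §1 The increment of one slot shrinks along growing sub-families -/

section Submodular

variable [DecidableEq I] [Fintype I] [∀ i, Fintype (E i)]

omit [DecidableEq I] in
/-- **DIMINISHING RETURNS.**  For sub-families `p ⊆ p'` and a slot `i₀`, with `q ⟺ p ∨ (· = i₀)` and
`q' ⟺ p' ∨ (· = i₀)`: `dim U(Σ|_{q'}) + dim U(Σ|_p) ≤ dim U(Σ|_q) + dim U(Σ|_{p'})` — the slot `i₀` adds at most as much
to the larger family as to the smaller one.  (`S ↦ dim U(Σ|_S)` is submodular; for `i₀` already in `p'` this is
monotonicity.) [cite: Gordon1999HodgeAVSurvey, §3 Theorem (proof) and 7.5–7.7] -/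
theorem finrank_antiSpan_sigmaType_submodular (Φ : ∀ i, Set (E i)) (p p' q q' : I → Prop) {i₀ : I}
    (hpp' : ∀ i, p i → p' i) (hq : ∀ i, q i ↔ p i ∨ i = i₀) (hq' : ∀ i, q' i ↔ p' i ∨ i = i₀) :
    Module.finrank ℚ (antiSpan G (sigmaType fun j : {i // q' i} => Φ j.1)) +
        Module.finrank ℚ (antiSpan G (sigmaType fun j : {i // p i} => Φ j.1)) ≤
      Module.finrank ℚ (antiSpan G (sigmaType fun j : {i // q i} => Φ j.1)) +
        Module.finrank ℚ (antiSpan G (sigmaType fun j : {i // p' i} => Φ j.1)) := by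
  classical
  -- the four families and the three restrictions
  let ιp : {i // p i} → {i // q i} := fun k => ⟨k.1, (hq k.1).2 (Or.inl k.2)⟩
  let ιp' : {i // p' i} → {i // q' i} := fun k => ⟨k.1, (hq' k.1).2 (Or.inl k.2)⟩
  let ιq : {i // q i} → {i // q' i} := fun k =>
    ⟨k.1, (hq' k.1).2 (((hq k.1).1 k.2).imp_left (hpp' k.1))⟩
  let Φq : ∀ j : {i // q i}, Set (E j.1) := fun j => Φ j.1
  let Φq' : ∀ j : {i // q' i}, Set (E j.1) := fun j => Φ j.1
  set Uq := antiSpan G (sigmaType Φq) with hUq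
  set Uq' := antiSpan G (sigmaType Φq') with hUq'
  set Up := antiSpan G (sigmaType fun j : {i // p i} => Φ j.1) with hUp
  set Up' := antiSpan G (sigmaType fun j : {i // p' i} => Φ j.1) with hUp'
  set Rp : ((Σ j : {i // q i}, E j.1) → ℚ) →ₗ[ℚ] ((Σ k : {i // p i}, E k.1) → ℚ) :=
    LinearMap.funLeft ℚ ℚ (fun y : (Σ k : {i // p i}, E (ιp k).1) => (⟨ιp y.1, y.2⟩ : Σ j : {i // q i}, E j.1))
    with hRp
  set Rp' : ((Σ j : {i // q' i}, E j.1) → ℚ) →ₗ[ℚ] ((Σ k : {i // p' i}, E k.1) → ℚ) :=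
    LinearMap.funLeft ℚ ℚ (fun y : (Σ k : {i // p' i}, E (ιp' k).1) => (⟨ιp' y.1, y.2⟩ : Σ j : {i // q' i}, E j.1))
    with hRp'
  set Rq : ((Σ j : {i // q' i}, E j.1) → ℚ) →ₗ[ℚ] ((Σ k : {i // q i}, E k.1) → ℚ) :=
    LinearMap.funLeft ℚ ℚ (fun y : (Σ k : {i // q i}, E (ιq k).1) => (⟨ιq y.1, y.2⟩ : Σ j : {i // q' i}, E j.1))
    with hRq
  -- rank–nullity for the two restrictions to `p`, `p'`
  have hrange : LinearMap.range (Rp ∘ₗ Uq.subtype) = Up := by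
    rw [LinearMap.range_comp, Submodule.range_subtype, hRp, hUq, hUp]
    exact map_funLeft_reindex_antiSpan_sigmaType (E := fun j : {i // q i} => E j.1) Φq ιp
  have hrange' : LinearMap.range (Rp' ∘ₗ Uq'.subtype) = Up' := by
    rw [LinearMap.range_comp, Submodule.range_subtype, hRp', hUq', hUp']
    exact map_funLeft_reindex_antiSpan_sigmaType (E := fun j : {i // q' i} => E j.1) Φq' ιp'
  set K := LinearMap.ker (Rp ∘ₗ Uq.subtype) with hK
  set K' := LinearMap.ker (Rp' ∘ₗ Uq'.subtype) with hK'
  have hsum : Module.finrank ℚ Up + Module.finrank ℚ K = Module.finrank ℚ Uq := by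
    rw [← hrange]; exact LinearMap.finrank_range_add_finrank_ker _
  have hsum' : Module.finrank ℚ Up' + Module.finrank ℚ K' = Module.finrank ℚ Uq' := by
    rw [← hrange']; exact LinearMap.finrank_range_add_finrank_ker _
  -- the restriction `q' → q` maps `U(Σ|_{q'})` into `U(Σ|_q)` and `K'` injectively into `K`
  have hRqmem : ∀ m : Uq', Rq m ∈ Uq := fun m => by
    have h := map_funLeft_reindex_antiSpan_sigmaType (G := G) (E := fun j : {i // q' i} => E j.1) Φq' ιq
    have hm : Rq m ∈ (antiSpan G (sigmaType Φq')).map Rq := Submodule.mem_map_of_mem (by rw [← hUq']; exact m.2)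
    rw [hRq] at hm ⊢
    rw [h] at hm
    exact hm
  let ψ₀ : Uq' →ₗ[ℚ] Uq := LinearMap.codRestrict Uq (Rq ∘ₗ Uq'.subtype) hRqmem
  have hψ₀K : ∀ m : K', ψ₀ m ∈ K := fun m => by
    have hm : Rp' (m : Uq') = 0 := m.2
    rw [hK, LinearMap.mem_ker, LinearMap.comp_apply, Submodule.subtype_apply]
    change Rp (Rq (m : Uq')) = 0
    funext y
    obtain ⟨k, t⟩ := y
    have := congrFun hm ⟨⟨k.1, hpp' k.1 k.2⟩, t⟩
    rw [hRp', LinearMap.funLeft_apply, Pi.zero_apply] at this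
    rw [hRp, hRq, LinearMap.funLeft_apply, LinearMap.funLeft_apply, Pi.zero_apply]
    exact this
  let ψ : K' →ₗ[ℚ] K := LinearMap.codRestrict K (ψ₀ ∘ₗ K'.subtype) hψ₀K
  have hψinj : Function.Injective ψ := by
    intro a b hab
    have hval : Rq ((a : Uq') : (Σ j : {i // q' i}, E j.1) → ℚ) = Rq ((b : Uq') : (Σ j : {i // q' i}, E j.1) → ℚ) :=
      congrArg (fun m : K => ((m : Uq) : (Σ j : {i // q i}, E j.1) → ℚ)) hab
    have ha : Rp' (a : Uq') = 0 := a.2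
    have hb : Rp' (b : Uq') = 0 := b.2
    apply Subtype.ext
    apply Subtype.ext
    funext x
    obtain ⟨j, t⟩ := x
    rcases (hq' j.1).1 j.2 with hj | hj
    · -- a `p'`-slot: both vanish
      have ha1 := congrFun ha ⟨⟨j.1, hj⟩, t⟩
      have hb1 := congrFun hb ⟨⟨j.1, hj⟩, t⟩
      rw [hRp', LinearMap.funLeft_apply, Pi.zero_apply] at ha1 hb1
      exact ha1.trans hb1.symm
    · -- the slot `i₀`: read through `Rq`
      have h1 := congrFun hval ⟨⟨j.1, (hq j.1).2 (Or.inr hj)⟩, t⟩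
      rw [hRq, LinearMap.funLeft_apply, LinearMap.funLeft_apply] at h1
      exact h1
  have hKK' : Module.finrank ℚ K' ≤ Module.finrank ℚ K := LinearMap.finrank_le_finrank_of_injective hψinj
  omega

omit [DecidableEq I] in
/-- **Rank form**: `rank(Σ|_{q'}) + rank(Σ|_p) ≤ rank(Σ|_q) + rank(Σ|_{p'})` for CM types (`p` nonempty).
[cite: Gordon1999HodgeAVSurvey, 7.5–7.7 and 9.1] -/
theorem typeRank_sigmaType_submodular {ρ : G} (Φ : ∀ i, Set (E i)) (h : ∀ i, IsCMTypeWith ρ (Φ i))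
    (p p' q q' : I → Prop) {i₀ : I} (hpp' : ∀ i, p i → p' i) (hq : ∀ i, q i ↔ p i ∨ i = i₀)
    (hq' : ∀ i, q' i ↔ p' i ∨ i = i₀) [Nonempty (Σ j : {i // p i}, E j.1)] :
    typeRank G (sigmaType fun j : {i // q' i} => Φ j.1) + typeRank G (sigmaType fun j : {i // p i} => Φ j.1) ≤
      typeRank G (sigmaType fun j : {i // q i} => Φ j.1) + typeRank G (sigmaType fun j : {i // p' i} => Φ j.1) := by
  classical
  obtain ⟨⟨⟨j₁, hj₁⟩, s₁⟩⟩ := ‹Nonempty (Σ j : {i // p i}, E j.1)›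
  haveI : Nonempty (Σ j : {i // p' i}, E j.1) := ⟨⟨⟨j₁, hpp' j₁ hj₁⟩, s₁⟩⟩
  haveI : Nonempty (Σ j : {i // q i}, E j.1) := ⟨⟨⟨j₁, (hq j₁).2 (Or.inl hj₁)⟩, s₁⟩⟩
  haveI : Nonempty (Σ j : {i // q' i}, E j.1) := ⟨⟨⟨j₁, (hq' j₁).2 (Or.inl (hpp' j₁ hj₁))⟩, s₁⟩⟩
  rw [(IsCMTypeWith.sigmaType (E := fun j : {i // q' i} => E j.1) fun j => h j.1).typeRank_eq_finrank_antiSpan_add_one,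
    (IsCMTypeWith.sigmaType (E := fun j : {i // p i} => E j.1) fun j => h j.1).typeRank_eq_finrank_antiSpan_add_one,
    (IsCMTypeWith.sigmaType (E := fun j : {i // q i} => E j.1) fun j => h j.1).typeRank_eq_finrank_antiSpan_add_one,
    (IsCMTypeWith.sigmaType (E := fun j : {i // p' i} => E j.1) fun j => h j.1).typeRank_eq_finrank_antiSpan_add_one]
  have := finrank_antiSpan_sigmaType_submodular (G := G) Φ p p' q q' hpp' hq hq'
  omega

end Submodular

/-! ### §2 The increment of one slot VANISHES iff the new type vector is generated by the kept ones -/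

section Increment

variable [DecidableEq I] [Fintype I] [∀ i, Fintype (E i)]

omit [DecidableEq I] in
/-- Reindexing the `p`-slots of the `q`-family by `{i // p i}` does not change the span (F1, both directions).
[cite: Gordon1999HodgeAVSurvey, §3 Theorem (proof)] -/
theorem finrank_antiSpan_sigmaType_nested_eq (Φ : ∀ i, Set (E i)) (p q : I → Prop) (hpq : ∀ i, p i → q i) :
    Module.finrank ℚ (antiSpan G (sigmaType fun k : {j : {i // q i} // p j.1} => Φ k.1.1)) =
      Module.finrank ℚ (antiSpan G (sigmaType fun k : {i // p i} => Φ k.1)) := by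
  classical
  refine le_antisymm ?_ ?_
  · exact finrank_antiSpan_sigmaType_reindex_le (G := G) (E := fun k : {i // p i} => E k.1) (fun k => Φ k.1)
      (fun k : {j : {i // q i} // p j.1} => (⟨k.1.1, k.2⟩ : {i // p i}))
  · exact finrank_antiSpan_sigmaType_reindex_le (G := G) (E := fun k : {j : {i // q i} // p j.1} => E k.1.1)
      (fun k => Φ k.1.1) (fun k : {i // p i} => (⟨⟨k.1, hpq k.1 k.2⟩, k.2⟩ : {j : {i // q i} // p j.1}))

/-- **THE INCREMENT VANISHES IFF THE NEW TYPE VECTOR IS GENERATED** (hypothesis-free): for a sub-family `p`, a slot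
`i₀ ∉ p` and `q ⟺ p ∨ (· = i₀)`, `dim U(Σ|_q) = dim U(Σ|_p)` iff `u_1(Φ_{i₀}) = Σ_{p j} φ_j(u_1(Φ_j))` with
`G`-equivariant linear `φ_j : ℚ^{E_j} → ℚ^{E_{i₀}}`.  On Hodge groups: the factor `A_{i₀}` adds no dimension to
`MT(∏_p A_j)` iff its type vector is an equivariant combination of theirs.
[cite: Gordon1999HodgeAVSurvey, §3 Theorem (proof) and 7.5–7.7] [cite: Serre1977, §1.3 Thm. 1] -/
theorem finrank_antiSpan_sigmaType_eq_iff_exists_generated (Φ : ∀ i, Set (E i)) (p q : I → Prop)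
    [DecidablePred p] [Fintype {i // p i}] {i₀ : I} (hi₀ : ¬ p i₀) (hq : ∀ i, q i ↔ p i ∨ i = i₀) :
    Module.finrank ℚ (antiSpan G (sigmaType fun j : {i // q i} => Φ j.1)) =
        Module.finrank ℚ (antiSpan G (sigmaType fun j : {i // p i} => Φ j.1)) ↔
      ∃ φ : ∀ j : {i // p i}, (E j.1 → ℚ) →ₗ[ℚ] (E i₀ → ℚ),
        (∀ j (g : G) (f : E j.1 → ℚ), φ j (fun y => f (g • y)) = fun z => φ j f (g • z)) ∧
        antiVec (Φ i₀) (1 : G) = ∑ j, φ j (antiVec (Φ j.1) (1 : G)) := by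
  classical
  let ι : {i // p i} → {i // q i} := fun k => ⟨k.1, (hq k.1).2 (Or.inl k.2)⟩
  constructor
  · intro heq
    obtain ⟨φ, hφ, hgen⟩ := exists_generated_of_finrank_antiSpan_sigmaType_eq_reindex
      (E := fun j : {i // q i} => E j.1) (fun j => Φ j.1) ι heq
    refine ⟨fun k => φ ⟨i₀, (hq i₀).2 (Or.inr rfl)⟩ k, fun k g f => hφ _ k g f, ?_⟩
    exact (hgen ⟨i₀, (hq i₀).2 (Or.inr rfl)⟩).trans
      (Finset.sum_congr (Finset.ext fun j => by simp only [Finset.mem_univ]) fun _ _ => rfl)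
  · rintro ⟨φ, hφ, hgen⟩
    -- generation off the `p`-slots of the `q`-family, then un-nest the index
    let e : {j : {i // q i} // p j.1} ≃ {i // p i} :=
      { toFun := fun k => ⟨k.1.1, k.2⟩
        invFun := fun k => ⟨ι k, k.2⟩
        left_inv := fun k => rfl
        right_inv := fun k => rfl }
    rw [← finrank_antiSpan_sigmaType_nested_eq (G := G) Φ p q fun i hi => (hq i).2 (Or.inl hi)]
    refine finrank_antiSpan_sigmaType_eq_restrict_of_exists_generated (E := fun j : {i // q i} => E j.1)
      (fun j => Φ j.1) (fun j => p j.1) fun j hj => ?_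
    have hj0 : j.1 = i₀ := ((hq j.1).1 j.2).resolve_left hj
    obtain ⟨j, hjq⟩ := j
    change j = i₀ at hj0
    subst hj0
    refine ⟨fun k => φ (e k), fun k g f => hφ (e k) g f, ?_⟩
    rw [hgen]
    exact Fintype.sum_equiv e.symm _ _ fun k => rfl

/-- **Rank form** for CM types: `rank(Σ|_q) = rank(Σ|_p)` iff `u_1(Φ_{i₀})` is an equivariant combination of the
`u_1(Φ_j)`, `p j` (`p` nonempty). [cite: Gordon1999HodgeAVSurvey, 7.5–7.7 and 9.1] -/
theorem typeRank_sigmaType_eq_iff_exists_generated {ρ : G} (Φ : ∀ i, Set (E i)) (h : ∀ i, IsCMTypeWith ρ (Φ i))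
    (p q : I → Prop) [DecidablePred p] [Fintype {i // p i}] {i₀ : I} (hi₀ : ¬ p i₀) (hq : ∀ i, q i ↔ p i ∨ i = i₀)
    [Nonempty (Σ j : {i // p i}, E j.1)] :
    typeRank G (sigmaType fun j : {i // q i} => Φ j.1) = typeRank G (sigmaType fun j : {i // p i} => Φ j.1) ↔
      ∃ φ : ∀ j : {i // p i}, (E j.1 → ℚ) →ₗ[ℚ] (E i₀ → ℚ),
        (∀ j (g : G) (f : E j.1 → ℚ), φ j (fun y => f (g • y)) = fun z => φ j f (g • z)) ∧
        antiVec (Φ i₀) (1 : G) = ∑ j, φ j (antiVec (Φ j.1) (1 : G)) := by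
  classical
  obtain ⟨⟨⟨j₁, hj₁⟩, s₁⟩⟩ := ‹Nonempty (Σ j : {i // p i}, E j.1)›
  haveI : Nonempty (Σ j : {i // q i}, E j.1) := ⟨⟨⟨j₁, (hq j₁).2 (Or.inl hj₁)⟩, s₁⟩⟩
  rw [(IsCMTypeWith.sigmaType (E := fun j : {i // q i} => E j.1) fun j => h j.1).typeRank_eq_finrank_antiSpan_add_one,
    (IsCMTypeWith.sigmaType (E := fun j : {i // p i} => E j.1) fun j => h j.1).typeRank_eq_finrank_antiSpan_add_one,
    Nat.add_right_cancel_iff]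
  exact finrank_antiSpan_sigmaType_eq_iff_exists_generated Φ p q hi₀ hq

end Increment

end Summit.HodgeConjecture.CorCM.IrrOdd

/-! ### §2 CM fields: `dim MT` of products is submodular in the set of factors -/

namespace Summit.HodgeConjecture.CorCM

open NumberField
open Literature.NumberTheory.ComplexMultiplication
open Literature.AlgebraicGeometry.Motives (CMType)
open Literature.AlgebraicGeometry.Pohlmann1968
open GenericCMField

variable {I : Type} [Fintype I] [DecidableEq I] {K : I → Type} [∀ i, Field (K i)] [∀ i, NumberField (K i)]
  [∀ i, IsCMField (K i)]

/-- **`dim MT` OF PRODUCTS IS SUBMODULAR IN THE SET OF FACTORS** (any CM fields): for sub-collections `T ⊆ T'`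
(`T ≠ ∅`) and any member `i`, `rank(Φ|_{T' ∪ {i}}) + rank(Φ|_T) ≤ rank(Φ|_{T ∪ {i}}) + rank(Φ|_{T'})` — the factor
`A_i` adds at most as many dimensions to `MT(∏_{T'} A_j)` as to `MT(∏_T A_j)`.
[cite: Gordon1999HodgeAVSurvey, §3 Theorem (proof), 7.5–7.7 and 9.1] [cite: Deligne1982HodgeCycles, I Ex. 3.7 (c)] -/
theorem cmFamilyRank_submodular (Φ : ∀ i, CMType (K i)) (T T' : Finset I) (hTT' : T ⊆ T') (hT : T.Nonempty)
    (i : I) :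
    CMAlgebra.cmFamilyRank (fun j : ↥(insert i T') => Φ j.1) + CMAlgebra.cmFamilyRank (fun j : T => Φ j.1) ≤
      CMAlgebra.cmFamilyRank (fun j : ↥(insert i T) => Φ j.1) + CMAlgebra.cmFamilyRank (fun j : T' => Φ j.1) := by
  obtain ⟨j₁, hj₁⟩ := hT
  obtain ⟨s₁⟩ : Nonempty (K j₁ →+* ℂ) := inferInstance
  haveI : Nonempty (Σ j : {j // j ∈ T}, (K j.1 →+* ℂ)) := ⟨⟨⟨j₁, hj₁⟩, s₁⟩⟩
  exact IrrOdd.typeRank_sigmaType_submodular (G := ℂ ≃+* ℂ) (E := fun i => K i →+* ℂ) (fun i => (Φ i).1)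
    (fun i => isCMTypeWith_conj (Φ i)) (· ∈ T) (· ∈ T') (· ∈ insert i T) (· ∈ insert i T') (fun j hj => hTT' hj)
    (fun j => by rw [Finset.mem_insert]; exact Or.comm) (fun j => by rw [Finset.mem_insert]; exact Or.comm)

/-- **Whole family**: `rank(Φ) + rank(Φ|_T) ≤ rank(Φ|_{T ∪ {i}}) + rank(Φ|_{≠ i})` for `i ∉ T ≠ ∅` — the last factor
adds at most as much to the product of all the others as to any sub-product.
[cite: Gordon1999HodgeAVSurvey, 7.5–7.7 and 9.1] -/
theorem cmFamilyRank_add_le (Φ : ∀ i, CMType (K i)) (T : Finset I) (hT : T.Nonempty) {i : I} (hi : i ∉ T) :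
    CMAlgebra.cmFamilyRank Φ + CMAlgebra.cmFamilyRank (fun j : T => Φ j.1) ≤
      CMAlgebra.cmFamilyRank (fun j : ↥(insert i T) => Φ j.1) +
        CMAlgebra.cmFamilyRank (fun j : {j // j ≠ i} => Φ j.1) := by
  classical
  obtain ⟨j₁, hj₁⟩ := hT
  obtain ⟨s₁⟩ : Nonempty (K j₁ →+* ℂ) := inferInstance
  haveI : Nonempty (Σ j : {j // j ∈ T}, (K j.1 →+* ℂ)) := ⟨⟨⟨j₁, hj₁⟩, s₁⟩⟩
  have h := IrrOdd.typeRank_sigmaType_submodular (G := ℂ ≃+* ℂ) (E := fun i => K i →+* ℂ) (fun i => (Φ i).1)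
    (fun i => isCMTypeWith_conj (Φ i)) (· ∈ T) (· ≠ i) (· ∈ insert i T) (fun _ => True)
    (fun j hj hji => hi (hji ▸ hj))
    (fun j => by rw [Finset.mem_insert]; exact Or.comm) (fun j => by simp only [true_iff]; exact em' _)
  -- the sub-family over `True` has the rank of the whole family
  have htrue : typeRank (ℂ ≃+* ℂ) (sigmaType fun j : {j : I // True} => (Φ j.1).1) = CMAlgebra.cmFamilyRank Φ := by
    change _ = typeRank (ℂ ≃+* ℂ) (sigmaType fun i => (Φ i).1)
    haveI : Nonempty (Σ j : {j : I // True}, (K j.1 →+* ℂ)) := ⟨⟨⟨j₁, trivial⟩, s₁⟩⟩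
    refine le_antisymm (IrrOdd.typeRank_sigmaType_reindex_le (E := fun i => K i →+* ℂ)
      (fun i => isCMTypeWith_conj (Φ i)) (Subtype.val : {j : I // True} → I)) ?_
    haveI : Nonempty (Σ i : I, (K ((fun j : {j : I // True} => j.1) ⟨i, trivial⟩) →+* ℂ)) := ⟨⟨j₁, s₁⟩⟩
    exact IrrOdd.typeRank_sigmaType_reindex_le (E := fun j : {j : I // True} => K j.1 →+* ℂ)
      (Φ := fun j : {j : I // True} => (Φ j.1).1) (fun j => isCMTypeWith_conj (Φ j.1))
      (fun i : I => (⟨i, trivial⟩ : {j : I // True}))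
  rw [htrue] at h
  exact h

/-- **ONE MORE FACTOR ADDS NOTHING TO THE MUMFORD–TATE GROUP IFF ITS TYPE VECTOR IS GENERATED** (any CM fields):
for `i ∉ T ≠ ∅`, `rank(Φ|_{T ∪ {i}}) = rank(Φ|_T)` iff `u_i = Σ_{j∈T} φ_j(u_j)` with `Aut(ℂ)`-equivariant linear
`φ_j : ℚ^{Hom(K_j,ℂ)} → ℚ^{Hom(K_i,ℂ)}`. [cite: Gordon1999HodgeAVSurvey, §3 Theorem (proof), 7.5–7.7 and 9.1]
[cite: Serre1977, §1.3 Thm. 1] -/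
theorem cmFamilyRank_insert_eq_iff (Φ : ∀ i, CMType (K i)) (T : Finset I) (hT : T.Nonempty) {i : I} (hi : i ∉ T) :
    CMAlgebra.cmFamilyRank (fun j : ↥(insert i T) => Φ j.1) = CMAlgebra.cmFamilyRank (fun j : T => Φ j.1) ↔
      ∃ φ : ∀ j : T, ((K j.1 →+* ℂ) → ℚ) →ₗ[ℚ] ((K i →+* ℂ) → ℚ),
        (∀ j (g : ℂ ≃+* ℂ) (f : (K j.1 →+* ℂ) → ℚ), φ j (fun y => f (g • y)) = fun z => φ j f (g • z)) ∧
        antiVec (Φ i).1 (1 : ℂ ≃+* ℂ) = ∑ j, φ j (antiVec (Φ j.1).1 (1 : ℂ ≃+* ℂ)) := by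
  obtain ⟨j₁, hj₁⟩ := hT
  obtain ⟨s₁⟩ : Nonempty (K j₁ →+* ℂ) := inferInstance
  haveI : Nonempty (Σ j : {j // j ∈ T}, (K j.1 →+* ℂ)) := ⟨⟨⟨j₁, hj₁⟩, s₁⟩⟩
  exact IrrOdd.typeRank_sigmaType_eq_iff_exists_generated (G := ℂ ≃+* ℂ) (E := fun i => K i →+* ℂ)
    (fun i => (Φ i).1) (fun i => isCMTypeWith_conj (Φ i)) (· ∈ T) (· ∈ insert i T) hi
    (fun j => by rw [Finset.mem_insert]; exact Or.comm)

omit [Fintype I] in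
/-- **… and when it adds nothing, the enlarged family is DEGENERATE** (`rank(Φ|_{T ∪ {i}}) = rank(Φ|_T) ≤
Σ_T [K_j:ℚ]/2 + 1`), so simple pairwise non-isogenous realisations carry an exceptional Hodge class on some product
(tree `CMAlgebra.exists_exceptional_prod_of_not_isNondegenerateFamily`). [cite: Gordon1999HodgeAVSurvey, 7.5–7.7] -/
theorem not_isNondegenerateFamily_insert_of_cmFamilyRank_eq (Φ : ∀ i, CMType (K i)) (T : Finset I)
    (hT : T.Nonempty) {i : I} (hi : i ∉ T)
    (h : CMAlgebra.cmFamilyRank (fun j : ↥(insert i T) => Φ j.1) = CMAlgebra.cmFamilyRank (fun j : T => Φ j.1)) :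
    ¬ CMAlgebra.IsNondegenerateFamily (fun j : ↥(insert i T) => Φ j.1) := by
  intro hnd
  haveI : Nonempty (T : Type) := hT.coe_sort
  rw [CMAlgebra.isNondegenerateFamily_iff, h] at hnd
  have hle := CMAlgebra.cmFamilyRank_le (fun j : T => Φ j.1)
  obtain ⟨s₀⟩ : Nonempty (K i →+* ℂ) := inferInstance
  have h2 : 2 ≤ Module.finrank ℚ (K i) := by
    rw [← Embeddings.card (K i) ℂ]
    exact Fintype.one_lt_card_iff_nontrivial.2
      ⟨⟨(starRingAut : ℂ ≃+* ℂ) • s₀, s₀, (isCMTypeWith_conj (Φ i)).rho_smul_ne s₀⟩⟩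
  have hsum : (∑ j : ↥(insert i T), Module.finrank ℚ (K j.1)) =
      Module.finrank ℚ (K i) + ∑ j : T, Module.finrank ℚ (K j.1) := by
    rw [Finset.sum_coe_sort (insert i T) fun j => Module.finrank ℚ (K j), Finset.sum_insert hi,
      Finset.sum_coe_sort T fun j => Module.finrank ℚ (K j)]
  rw [hsum] at hnd
  omega

end Summit.HodgeConjecture.CorCM

end
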